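import Summits.RiemannHypothesis.RiemannHypothesis.Theorems.MotivicDoorDecreeHadamard
import Summits.RiemannHypothesis.RiemannHypothesis.Theorems.WeilGroundStateGroundStateSimpleEvenStubHyperbolicBounds
import HarnessLib

/-!
# Motivic door (Connes–Consani): the archimedean residual kernel to third order

Honest framing (cell `pub-rhdoor`, cc-3, verbatim): "lottery ticket at the motivic door; RH
probability negligible; consolation prizes are real: a new semi-local Weil-positivity theorem, or a
located gap in the Connes–Consani programme, plus the ff-door theorem".  No RH content below;
value = theorem (pure real analysis of Bombieri's archimedean kernel).

`MotivicDoorArchResidualSecondOrder` proved `|k_r(x) + ½| ≤ x/4` on `(0, 1]` for the residual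
archimedean kernel `k_r(x) = 1/x − e^{x/2}/sinh x = archResidualKernel x`, and
`MotivicDoorDecreeHadamard` rewrote it as `|K(t) − ¼| ≤ t/8` for the Hadamard kernel
`K(t) = weilArchDensity t − 1/(2t) = −k_r(t)/2` of the decreed distribution `N` at `u = 1`,
with the second-order dilation law
`|N(toMul φ(·/ε)) − [first order + ε/4 ∫φ]| ≤ ε²/8 ∫ s|φ|`.
This file goes one order further, with SHARP constants:

PROVED (RH-free, Suzuki-free, Weil-criterion-free):
* `abs_exp_sub_taylor_five_le`, `abs_sinh_sub_taylor_five_le`: Taylor remainders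
  (`Real.exp_bound`; the seven-term `exp` estimate is the landed
  `GroundStateSimpleEven.hyp_abs_exp_sub_taylor_seven_le`, imported, not re-derived).
* `archResidualNumer_nonneg`, `archResidualNumer_le`: for `0 < x ≤ 1`,
  `0 ≤ (24 + 12x − x²) sinh x − 24x e^{x/2} ≤ (3/2) x³ sinh x`.
* `abs_archResidualKernel_add_half_sub_le`: `|k_r(x) + ½ − x/24| ≤ x²/16` on `(0, 1]`
  (`k_r = −½ + x/24 + x²/16 + O(x³)`: the constant `1/16` is attained at `0⁺`).
* `abs_weilArchDensity_sub_inv_sub_quarter_add_le`: `|K(t) − ¼ + t/48| ≤ t²/32` on `(0, 1]`;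
  `tendsto_weilArchDensity_sub_inv_sub_quarter_div`: `(K(t) − ¼)/t → −1/48` as `t → 0⁺`
  (`K = ¼ − t/48 − t²/32 + O(t³)`).
* `abs_ccN_toMul_dilate_sub_third_le`: the THIRD-ORDER dilation law — for a real Weil test `φ`
  vanishing off `(−ρ, ρ)`, `0 < ε ≤ 1`, `ερ ≤ ½`:
  `|N(toMul φ(·/ε)) − [(½(γ + log 2π) + ½ log ε)φ(0) + ∫₁^∞ φ ds/(2s)`
  `  − ∫₀¹ (φ(0) − φ) ds/(2s) + ε/4 ∫₀^∞ φ − ε²/48 ∫₀^∞ s φ(s) ds]|`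
  `  ≤ ε³/32 ∫₀^∞ s² |φ(s)| ds`.

PRINTED (Connes, Essay, arXiv:1509.05576, p. 14 l. 45–57, eq. (27)): the archimedean part of `N`
is the distribution `∫₁^∞ κ(u) f(u) d*u = ∫₁^∞ (u² f(u) − f(1))/(u² − 1) d*u + c f(1)` (principal
value at `u = 1`; Connes–Consani arXiv:1805.10501 §3.1); the kernel `e^{t/2}/(2 sinh t)` is the
archimedean density of Bombieri 2000, Thm 2.  READING (ours): the bounded part
`K = e^{t/2}/(2 sinh t) − 1/(2t)` of that principal value is `C²` down to `t = 0⁺` with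
`K(0⁺) = ¼`, `K′(0⁺) = −1/48`, and the dilation law of `N` inherits one more exact term; the
constants `1/16`, `1/32` are the Taylor coefficients, hence sharp.  Neither source states these
expansions; they are elementary and RH-free.
NOT CLAIMED: anything about the zeros, `ω`, or positivity; nothing in this file bears on RH.
DATA: exact rational Taylor coefficients cross-checked with `fractions` arithmetic
(`k_series_check.py`, unit folder): `K = ¼ − t/48 − t²/32 + 7t³/11520 + O(t⁴)`; no floating-point
input to any proof.
References: Bombieri 2000 (Thm 2); Connes, arXiv:1509.05576 §4.1 eq. (27); Connes–Consani,
arXiv:1805.10501 §3.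
-/

noncomputable section

set_option linter.dupNamespace false

open Complex Set MeasureTheory Filter Topology Literature.NumberTheory.LFunctions
open Literature.NumberTheory.ConnesConsani2019
open Summit.RiemannHypothesis.RiemannHypothesis.Theorems.MotivicDoor.ArchLogLaplacian
open scoped Real

namespace Summit.RiemannHypothesis.RiemannHypothesis.Theorems.MotivicDoor.ConnesConsani

variable {φ : ℝ → ℝ}

/-! ## 1. Taylor remainders -/

/-- `|e^y − (1 + y + y²/2 + y³/6 + y⁴/24 + y⁵/120)| ≤ 7|y|⁶/4320` on `[-1, 1]`
(`Real.exp_bound`, `n = 6`). -/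
theorem abs_exp_sub_taylor_five_le {y : ℝ} (hy : |y| ≤ 1) :
    |Real.exp y - (1 + y + y ^ 2 / 2 + y ^ 3 / 6 + y ^ 4 / 24 + y ^ 5 / 120)| ≤
      7 * |y| ^ 6 / 4320 := by
  have h := Real.exp_bound hy (n := 6) (by norm_num)
  have e : ∑ m ∈ Finset.range 6, y ^ m / (m.factorial : ℝ) =
      1 + y + y ^ 2 / 2 + y ^ 3 / 6 + y ^ 4 / 24 + y ^ 5 / 120 := by
    simp [Finset.sum_range_succ, Nat.factorial]
  rw [e] at h
  refine h.trans (le_of_eq ?_)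
  norm_num [Nat.factorial]
  ring

/-- `|sinh x − (x + x³/6 + x⁵/120)| ≤ |x|⁷/4410` on `[-1, 1]` (from the landed seven-term
estimate `GroundStateSimpleEven.hyp_abs_exp_sub_taylor_seven_le` at `±x`). -/
theorem abs_sinh_sub_taylor_five_le {x : ℝ} (hx : |x| ≤ 1) :
    |Real.sinh x - (x + x ^ 3 / 6 + x ^ 5 / 120)| ≤ |x| ^ 7 / 4410 := by
  have h1 := GroundStateSimpleEven.hyp_abs_exp_sub_taylor_seven_le hx
  have h2 := GroundStateSimpleEven.hyp_abs_exp_sub_taylor_seven_le (x := -x) (by rwa [abs_neg])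
  rw [abs_neg] at h2
  have e : Real.sinh x - (x + x ^ 3 / 6 + x ^ 5 / 120) =
      ((Real.exp x - (1 + x + x ^ 2 / 2 + x ^ 3 / 6 + x ^ 4 / 24 + x ^ 5 / 120 + x ^ 6 / 720)) -
        (Real.exp (-x) - (1 + -x + (-x) ^ 2 / 2 + (-x) ^ 3 / 6 + (-x) ^ 4 / 24 + (-x) ^ 5 / 120 +
          (-x) ^ 6 / 720))) / 2 := by
    rw [Real.sinh_eq]
    ring
  rw [e, abs_div, abs_two, div_le_iff₀ (by norm_num : (0 : ℝ) < 2)]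
  calc _ ≤ _ := abs_sub _ _
    _ ≤ |x| ^ 7 / 4410 + |x| ^ 7 / 4410 := add_le_add h1 h2
    _ = |x| ^ 7 / 4410 * 2 := by ring

/-! ## 2. The numerator of `k_r + ½ − x/24` -/

/-- The algebra:
`k_r(x) + ½ − x/24 = [(24 + 12x − x²) sinh x − 24x e^{x/2}] / (24 x sinh x)` for `x ≠ 0`. -/
theorem archResidualKernel_add_half_sub_eq {x : ℝ} (hx : x ≠ 0) :
    archResidualKernel x + 1 / 2 - x / 24 =
      ((24 + 12 * x - x ^ 2) * Real.sinh x - 24 * x * Real.exp (x / 2)) /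
        (24 * x * Real.sinh x) := by
  have hs : Real.sinh x ≠ 0 := Real.sinh_ne_zero.2 hx
  unfold archResidualKernel
  field_simp
  ring

/-- Decomposition of the numerator into its Taylor polynomial
`(3/2)x⁴ − 7x⁵/240 + 3x⁶/32 − x⁷/120` plus remainders of size `O(x⁷)`, `O(x⁷)`. -/
private theorem numer_eq (x : ℝ) :
    (24 + 12 * x - x ^ 2) * Real.sinh x - 24 * x * Real.exp (x / 2) =
      3 / 2 * x ^ 4 - 7 / 240 * x ^ 5 + 3 / 32 * x ^ 6 - x ^ 7 / 120 +
        (24 + 12 * x - x ^ 2) * (Real.sinh x - (x + x ^ 3 / 6 + x ^ 5 / 120)) -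
          24 * x * (Real.exp (x / 2) - (1 + x / 2 + (x / 2) ^ 2 / 2 + (x / 2) ^ 3 / 6 +
            (x / 2) ^ 4 / 24 + (x / 2) ^ 5 / 120)) := by
  ring

/-- Remainder control on `(0, 1]`: the two Taylor remainders of `numer_eq` contribute at most
`x⁵/100` in absolute value. -/
private theorem numer_rem_le {x : ℝ} (hx : 0 < x) (hx1 : x ≤ 1) :
    |(24 + 12 * x - x ^ 2) * (Real.sinh x - (x + x ^ 3 / 6 + x ^ 5 / 120)) -
        24 * x * (Real.exp (x / 2) - (1 + x / 2 + (x / 2) ^ 2 / 2 + (x / 2) ^ 3 / 6 +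
          (x / 2) ^ 4 / 24 + (x / 2) ^ 5 / 120))| ≤ x ^ 5 / 100 := by
  have hax : |x| ≤ 1 := by rwa [abs_of_pos hx]
  have h1 := abs_sinh_sub_taylor_five_le hax
  rw [abs_of_pos hx] at h1
  have h2 := abs_exp_sub_taylor_five_le (y := x / 2)
    (by rw [abs_of_pos (by positivity)]; linarith)
  rw [abs_of_pos (by positivity : (0 : ℝ) < x / 2)] at h2
  have hP : |24 + 12 * x - x ^ 2| ≤ 36 := by
    rw [abs_le]; constructor <;> nlinarith
  have hx7 : x ^ 7 ≤ x ^ 5 := by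
    calc x ^ 7 = x ^ 5 * (x * x) := by ring
      _ ≤ x ^ 5 * (1 * 1) := by gcongr
      _ = x ^ 5 := by ring
  have hx6 : x * x ^ 6 ≤ x ^ 5 := by
    calc x * x ^ 6 = x ^ 5 * (x * x) := by ring
      _ ≤ x ^ 5 * (1 * 1) := by gcongr
      _ = x ^ 5 := by ring
  calc _ ≤ |(24 + 12 * x - x ^ 2) * (Real.sinh x - (x + x ^ 3 / 6 + x ^ 5 / 120))| +
        |24 * x * (Real.exp (x / 2) - (1 + x / 2 + (x / 2) ^ 2 / 2 + (x / 2) ^ 3 / 6 +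
          (x / 2) ^ 4 / 24 + (x / 2) ^ 5 / 120))| := abs_sub _ _
    _ ≤ 36 * (x ^ 7 / 4410) + 24 * x * (7 * (x / 2) ^ 6 / 4320) := by
        rw [abs_mul, abs_mul, abs_of_pos (by positivity : (0 : ℝ) < 24 * x)]
        exact add_le_add (mul_le_mul hP h1 (abs_nonneg _) (by norm_num))
          (mul_le_mul_of_nonneg_left h2 (by positivity))
    _ = 36 / 4410 * x ^ 7 + 7 / 11520 * (x * x ^ 6) := by ring
    _ ≤ 36 / 4410 * x ^ 5 + 7 / 11520 * x ^ 5 :=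
        add_le_add (mul_le_mul_of_nonneg_left hx7 (by norm_num))
          (mul_le_mul_of_nonneg_left hx6 (by norm_num))
    _ ≤ x ^ 5 / 100 := by linarith [pow_pos hx 5]

/-- **The numerator is non-negative on `(0, 1]`**:
`0 ≤ (24 + 12x − x²) sinh x − 24x e^{x/2}`
(its Taylor series starts `(3/2)x⁴ − 7x⁵/240 + …`).
PROVED. -/
theorem archResidualNumer_nonneg {x : ℝ} (hx : 0 < x) (hx1 : x ≤ 1) :
    0 ≤ (24 + 12 * x - x ^ 2) * Real.sinh x - 24 * x * Real.exp (x / 2) := by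
  have hR := numer_rem_le hx hx1
  rw [numer_eq]
  obtain ⟨hRl, -⟩ := abs_le.1 hR
  have hx5 : x ^ 5 ≤ x ^ 4 := by
    calc x ^ 5 = x ^ 4 * x := by ring
      _ ≤ x ^ 4 * 1 := by gcongr
      _ = x ^ 4 := by ring
  have hx7 : x ^ 7 ≤ x ^ 4 := by
    calc x ^ 7 = x ^ 4 * x ^ 3 := by ring
      _ ≤ x ^ 4 * 1 := by gcongr; exact pow_le_one₀ hx.le hx1
      _ = x ^ 4 := by ring
  linarith [pow_pos hx 4, pow_pos hx 6]

/-- **The numerator is at most `(3/2) x³ sinh x` on `(0, 1]`**: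
`(24 + 12x − x²) sinh x − 24x e^{x/2} ≤ (3/2) x³ sinh x` (the difference has Taylor series
`−7x⁵/240 − 5x⁶/32 − …`).  PROVED. -/
theorem archResidualNumer_le {x : ℝ} (hx : 0 < x) (hx1 : x ≤ 1) :
    (24 + 12 * x - x ^ 2) * Real.sinh x - 24 * x * Real.exp (x / 2) ≤
      3 / 2 * x ^ 3 * Real.sinh x := by
  have hR := numer_rem_le hx hx1
  have hax : |x| ≤ 1 := by rwa [abs_of_pos hx]
  have hS := abs_sinh_sub_taylor_five_le hax
  rw [abs_of_pos hx] at hS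
  obtain ⟨-, hRu⟩ := abs_le.1 hR
  obtain ⟨hSl, -⟩ := abs_le.1 hS
  -- sinh x ≥ x + x³/6 + x⁵/120 − x⁷/4410 ≥ x + x³/6
  have hsinh : x + x ^ 3 / 6 ≤ Real.sinh x := by
    have hx7 : x ^ 7 ≤ x ^ 5 := by
      calc x ^ 7 = x ^ 5 * (x * x) := by ring
        _ ≤ x ^ 5 * (1 * 1) := by gcongr
        _ = x ^ 5 := by ring
    linarith [pow_pos hx 5]
  rw [numer_eq]
  have hx6 : x ^ 6 ≤ x ^ 5 := by
    calc x ^ 6 = x ^ 5 * x := by ring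
      _ ≤ x ^ 5 * 1 := by gcongr
      _ = x ^ 5 := by ring
  have h3 : 3 / 2 * x ^ 3 * (x + x ^ 3 / 6) ≤ 3 / 2 * x ^ 3 * Real.sinh x :=
    mul_le_mul_of_nonneg_left hsinh (by positivity)
  linarith [pow_pos hx 5, pow_pos hx 6, pow_pos hx 7]

/-! ## 3. The kernel to third order -/

/-- **`k_r(x) = −½ + x/24 + O(x²)` with the sharp constant**:
`|k_r(x) + ½ − x/24| ≤ x²/16` for `0 < x ≤ 1` (`k_r = archResidualKernel`; the Taylor series
is `−½ + x/24 + x²/16 − 7x³/5760 − …`, so `1/16` is attained at `0⁺`).  PROVED. -/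
theorem abs_archResidualKernel_add_half_sub_le {x : ℝ} (hx : 0 < x) (hx1 : x ≤ 1) :
    |archResidualKernel x + 1 / 2 - x / 24| ≤ x ^ 2 / 16 := by
  have hs : 0 < Real.sinh x := Real.sinh_pos_iff.2 hx
  rw [archResidualKernel_add_half_sub_eq hx.ne', abs_div,
    abs_of_pos (by positivity : 0 < 24 * x * Real.sinh x), div_le_iff₀ (by positivity),
    abs_of_nonneg (archResidualNumer_nonneg hx hx1)]
  calc _ ≤ 3 / 2 * x ^ 3 * Real.sinh x := archResidualNumer_le hx hx1
    _ = x ^ 2 / 16 * (24 * x * Real.sinh x) := by ring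

/-- **`K(t) = ¼ − t/48 + O(t²)` with the sharp constant**: `|K(t) − ¼ + t/48| ≤ t²/32` on
`(0, 1]`, `K(t) = weilArchDensity t − 1/(2t) = −k_r(t)/2` the Hadamard kernel of `N` at `u = 1`
(`K = ¼ − t/48 − t²/32 + 7t³/11520 + …`).  PROVED. -/
theorem abs_weilArchDensity_sub_inv_sub_quarter_add_le {t : ℝ} (ht : 0 < t) (ht1 : t ≤ 1) :
    |weilArchDensity t - 1 / (2 * t) - 1 / 4 + t / 48| ≤ t ^ 2 / 32 := by
  have h := abs_archResidualKernel_add_half_sub_le ht ht1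
  rw [weilArchDensity_sub_inv_eq_neg_archResidualKernel_div,
    show -(archResidualKernel t / 2) - 1 / 4 + t / 48 =
      -((archResidualKernel t + 1 / 2 - t / 24) / 2) by ring,
    abs_neg, abs_div, abs_two]
  linarith

/-- **`K′(0⁺) = −1/48`**: `(K(t) − ¼)/t → −1/48` as `t → 0⁺`.  PROVED. -/
theorem tendsto_weilArchDensity_sub_inv_sub_quarter_div :
    Tendsto (fun t ↦ (weilArchDensity t - 1 / (2 * t) - 1 / 4) / t) (𝓝[>] 0)
      (𝓝 (-(1 / 48))) := by
  rw [Metric.tendsto_nhdsWithin_nhds]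
  intro ε hε
  refine ⟨min 1 (32 * ε), by positivity, fun t ht htd ↦ ?_⟩
  have ht0 : 0 < t := ht
  have ht0' : t ≠ 0 := ht0.ne'
  rw [Real.dist_eq, sub_zero, abs_of_pos ht0] at htd
  have ht1 : t ≤ 1 := ((lt_min_iff.1 htd).1).le
  have hte : t < 32 * ε := (lt_min_iff.1 htd).2
  have h := abs_weilArchDensity_sub_inv_sub_quarter_add_le ht0 ht1
  rw [Real.dist_eq, show (weilArchDensity t - 1 / (2 * t) - 1 / 4) / t - -(1 / 48) =
      (weilArchDensity t - 1 / (2 * t) - 1 / 4 + t / 48) / t by field_simp; ring,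
    abs_div, abs_of_pos ht0, div_lt_iff₀ ht0]
  calc _ ≤ t ^ 2 / 32 := h
    _ = t / 32 * t := by ring
    _ < ε * t := by gcongr; linarith

/-! ## 4. The third-order dilation law of `N` at `u = 1` -/

/-- `K(ε·) φ` is integrable on `(0, ∞)` for a real Weil test `φ` and `ε > 0`
(`|K| ≤ ¼`). -/
private theorem hd3_integrableOn_dilate_mul (hφ : IsWeilTest fun t ↦ (φ t : ℂ)) {ε : ℝ}
    (hε : 0 < ε) :
    IntegrableOn (fun s ↦ (weilArchDensity (ε * s) - 1 / (2 * (ε * s))) * φ s) (Ioi 0) := by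
  have hm : Measurable fun s ↦ weilArchDensity (ε * s) - 1 / (2 * (ε * s)) :=
    (measurable_weilArchDensity.comp (measurable_const.mul measurable_id)).sub
      (measurable_const.div (measurable_const.mul (measurable_const.mul measurable_id)))
  exact Integrable.bdd_mul (c := 1 / 4) (integrable_of_isWeilTest hφ).integrableOn
    hm.aestronglyMeasurable (by
      filter_upwards [ae_restrict_mem measurableSet_Ioi] with s hs
      exact (Real.norm_eq_abs _).trans_le (abs_weilArchDensity_sub_inv_le (mul_pos hε hs)))

/-- Weighted moments `s ↦ s^n |φ s|` and `s ↦ s^n φ s` of a real Weil test vanishing off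
`(−ρ, ρ)` are integrable. -/
private theorem hd3_integrable_pow_mul (hφ : IsWeilTest fun t ↦ (φ t : ℂ)) {ρ : ℝ}
    (hρ : ∀ t, ρ ≤ |t| → φ t = 0) (n : ℕ) :
    Integrable (fun s ↦ s ^ n * φ s) ∧ Integrable (fun s ↦ s ^ n * |φ s|) := by
  have hK : ∀ g : ℝ → ℝ, Continuous g → (∀ s, φ s = 0 → g s = 0) →
      Integrable g := by
    intro g hg h0
    refine hg.integrable_of_hasCompactSupport (HasCompactSupport.intro (K := Icc (-ρ) ρ)
      isCompact_Icc fun s hs ↦ h0 s ?_)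
    have h : ρ ≤ |s| := by
      rw [mem_Icc, not_and_or, not_le, not_le] at hs
      rcases hs with h | h <;> linarith [neg_le_abs s, le_abs_self s]
    exact hρ s h
  have hc := (AWS.contDiff_of_isWeilTest hφ).continuous
  exact ⟨hK _ ((continuous_pow n).mul hc) fun s h ↦ by simp [h],
    hK _ ((continuous_pow n).mul hc.abs) fun s h ↦ by simp [h]⟩

/-- **Third-order dilation law.**  For a real Weil test `φ` vanishing off `(−ρ, ρ)`,
`0 < ε ≤ 1`, `ε ρ ≤ ½`:  `|N(toMul φ(·/ε)) − [(½(γ + log 2π) + ½ log ε) φ(0)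
  + ∫₁^∞ φ ds/(2s) − ∫₀¹ (φ(0) − φ) ds/(2s) + ε/4 ∫₀^∞ φ − ε²/48 ∫₀^∞ s φ(s) ds]|
  ≤ ε³/32 ∫₀^∞ s² |φ(s)| ds`.
PROVED (`|K(εs) − ¼ + εs/48| ≤ (εs)²/32` on the support of `φ`, where `εs ≤ ½`). -/
theorem abs_ccN_toMul_dilate_sub_third_le (hφ : IsWeilTest fun t ↦ (φ t : ℂ)) {ρ : ℝ}
    (hρ : ∀ t, ρ ≤ |t| → φ t = 0) {ε : ℝ} (hε : 0 < ε) (hε1 : ε ≤ 1) (hερ : ε * ρ ≤ 1 / 2) :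
    |ccN (toMul fun t ↦ φ (t / ε)) -
        (((Real.eulerMascheroniConstant + Real.log (2 * π)) / 2 + Real.log ε / 2) * φ 0 +
            ((∫ s in Ioi 1, φ s / (2 * s)) - ∫ s in Ioc 0 1, (φ 0 - φ s) / (2 * s)) +
          ((ε / 4 * ∫ s in Ioi 0, φ s) - ε ^ 2 / 48 * ∫ s in Ioi 0, s * φ s))| ≤
      ε ^ 3 / 32 * ∫ s in Ioi 0, s ^ 2 * |φ s| := by
  have hKφ := hd3_integrableOn_dilate_mul hφ hε
  obtain ⟨hm1, -⟩ := hd3_integrable_pow_mul hφ hρ 1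
  obtain ⟨-, hm2⟩ := hd3_integrable_pow_mul hφ hρ 2
  have hφi : Integrable φ := integrable_of_isWeilTest hφ
  simp only [pow_one] at hm1
  -- the model integrand `(¼ − εs/48) φ(s)`
  have hmod : IntegrableOn (fun s ↦ (1 / 4 - ε * s / 48) * φ s) (Ioi 0) := by
    have h : IntegrableOn (fun s ↦ 1 / 4 * φ s - ε / 48 * (s * φ s)) (Ioi 0) :=
      (hφi.const_mul _).integrableOn.sub (hm1.const_mul _).integrableOn
    exact h.congr_fun (fun s _ ↦ by ring) measurableSet_Ioi
  have hsplit : (ε / 4 * ∫ s in Ioi 0, φ s) - ε ^ 2 / 48 * ∫ s in Ioi 0, s * φ s =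
      ε * ∫ s in Ioi 0, (1 / 4 - ε * s / 48) * φ s := by
    rw [show (fun s ↦ (1 / 4 - ε * s / 48) * φ s) =
        fun s ↦ 1 / 4 * φ s - ε / 48 * (s * φ s) by funext s; ring,
      integral_sub (hφi.const_mul _).integrableOn (hm1.const_mul _).integrableOn,
      integral_const_mul, integral_const_mul]
    ring
  rw [ccN_toMul_dilate_eq_hadamard hφ hρ hε hε1 hερ, hsplit, add_sub_add_left_eq_sub,
    ← mul_sub, ← integral_sub hKφ hmod, abs_mul, abs_of_pos hε,
    show ε ^ 3 / 32 * ∫ s in Ioi 0, s ^ 2 * |φ s| =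
      ε * ∫ s in Ioi 0, ε ^ 2 / 32 * (s ^ 2 * |φ s|) by rw [integral_const_mul]; ring]
  refine mul_le_mul_of_nonneg_left ((Real.norm_eq_abs _).symm.trans_le
    (norm_integral_le_of_norm_le (hm2.integrableOn.const_mul _) ?_)) hε.le
  filter_upwards [ae_restrict_mem measurableSet_Ioi] with s hs
  rw [Real.norm_eq_abs, ← sub_mul, abs_mul,
    show ε ^ 2 / 32 * (s ^ 2 * |φ s|) = (ε * s) ^ 2 / 32 * |φ s| by ring]
  by_cases h0 : φ s = 0
  · simp [h0]
  refine mul_le_mul_of_nonneg_right ?_ (abs_nonneg _)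
  have hsρ : s < ρ := by
    simpa only [abs_of_pos (mem_Ioi.1 hs)] using lt_of_not_ge (mt (hρ s) h0)
  have h := abs_weilArchDensity_sub_inv_sub_quarter_add_le (mul_pos hε hs)
    ((mul_le_mul_of_nonneg_left hsρ.le hε.le).trans (hερ.trans (by norm_num)))
  rwa [show weilArchDensity (ε * s) - 1 / (2 * (ε * s)) - 1 / 4 + ε * s / 48 =
    weilArchDensity (ε * s) - 1 / (2 * (ε * s)) - (1 / 4 - ε * s / 48) by ring] at h

end Summit.RiemannHypothesis.RiemannHypothesis.Theorems.MotivicDoor.ConnesConsani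

end
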